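import Mathlib
import Summits.ResolutionOfSingularities.ResolutionOfSingularities.Theorems.RadicialJungCleanModelsCleanPatchingPrincipalization
import Literature.AlgebraicGeometry.Resolution.BadCurveInduction
import HarnessLib

/-!
# Route `RadicialJung`, crux `CleanModels` (stmt-ResolutionOfSingularities-15917), line `Sketch` rev 14, stub 4b
# `stub_cleanTwoModelPatching3`: Zariski–Piltant patching for `P_clean`, Step 5 (no bad curves)

Kernel transfer, part 4: the `P_clean` twin of `ProjModel.exists_regLe_pair_of_closure_subset`
(`Literature/AlgebraicGeometry/Resolution/PatchingStepFive.lean`; Piltant 2013, proof of Prop. 5.1, Step 5, the gluing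
replaced by the join).  Setting: `η : B → A` a morphism of projective models of `K/k` (`trdeg_k K = 3`, `char k = p`),
a non-empty open `U ⊆ A` of CLEAN-REGULAR points for the `K^p`-line of `g₀` such that no point of indeterminacy of
`A ⋯→ B` inside `U` specialises out of `U`, and an open `U_B ⊆ B` of clean-regular points.  Conclusion: a projective
model `Y` dominating `A` and `B`, clean-regular over `U` and over `U_B`.  As printed/for `P_reg`: `Y = J(A″, B)` with
`ρ : A″ → A` the extension of a principalization ON `U` of the base ideal of `A ⋯→ B` — here by the hypothesis `hT4`
(Axiom 4 for `P_clean`, `exists_cleanExtension`, which makes `A″` clean-regular over `U`); `Y` is `A″` over the open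
of definition of `A″ ⋯→ B` (⊇ `ρ⁻¹(U)`) and is `B` over `η⁻¹(P)`, `P = A ∖ closure(Ind ∩ U) ⊇ A ∖ U`, along local
isomorphisms, which preserve clean-regularity (`ModelCleanRegAt.of_isIso_morphismRestrict`).

* `exists_cleanLe_pair_of_closure_subset` — Step 5 for `P_clean`.

All PROVED (modulo the hypothesis `hT4`); nothing here proves resolution in characteristic `p`.
-/

noncomputable section

set_option linter.dupNamespace false -- mandated namespace of this single-conjunct summit

open CategoryTheory CategoryTheory.Limits AlgebraicGeometry TopologicalSpace IsLocalRing
open Literature.AlgebraicGeometry.Resolution Literature.AlgebraicGeometry.Motives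
open Literature.AlgebraicGeometry.Resolution.ProjModel

namespace Summit.ResolutionOfSingularities.ResolutionOfSingularities.Theorems.RadicialJung.CleanModels

variable {p : ℕ} {k K : Type} [Field k] [Field K] [Algebra k K]

/-- **Zariski–Piltant patching for `P_clean`, Step 5, over an open of clean-regular points** (twin of
`ProjModel.exists_regLe_pair_of_closure_subset`; Piltant 2013, proof of Prop. 5.1, Step 5): let `η : B → A` be a
morphism of projective models of `K/k` (`trdeg_k K = 3`, `char k = p`), `U ⊆ A` a non-empty open of clean-regular
points for the `K^p`-line of `g₀` such that the closure of `Ind ∩ U` stays inside `U` (`Ind` = the points of `A` whose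
local ring has no centre on `B`; "there exists no bad `x`"), and `U_B ⊆ B` an open of clean-regular points.  Assuming
`hT4`, there is a projective model `Y` of `K/k` with morphisms of models `ψ_A : Y → A`, `ψ_B : Y → B` such that `Y` is
clean-regular over `U` and over `U_B`. [cite: Piltant2013, Prop. 5.1 (proof, Step 5)] -/
theorem exists_cleanLe_pair_of_closure_subset
    (hT4 : ∀ (p : ℕ), p.Prime → ∀ (S : Scheme.{0}) [IsIntegral S] [IsNoetherian S],
      CharP S.functionField p → Scheme.IsRegular S → Scheme.IsExcellent S → topologicalKrullDim S = 3 →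
      ∀ G : S.functionField, (∀ s : S, CleanRegAt p (algebraMap (S.presheaf.stalk s) S.functionField) G) →
      ∀ J : S.IdealSheafData, J ≠ ⊥ →
      ∃ (S' : Scheme.{0}) (σ : S' ⟶ S) (_ : IsIntegral S') (_ : IsDominant σ),
      IsRegularCentreBlowupSeq σ J ∧ IsLocallyPrincipal (J.comap σ) ∧
      ∀ s' : S', CleanRegAt p (algebraMap (S'.presheaf.stalk s') S'.functionField) (RatFn.functionFieldMap σ G))
    (hp : p.Prime) [CharP k p] (htr : Algebra.trdeg k K = 3) (g₀ : K) (A B : ProjModel k K) (η : B.Hom A)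
    (U : A.X.Opens) (hU : ∀ a ∈ U, ModelCleanRegAt p g₀ A a) (hUne : (U : Set A.X).Nonempty)
    (UB : B.X.Opens) (hUB : ∀ b ∈ UB, ModelCleanRegAt p g₀ B b)
    (hnb : closure ({a : A.X | ¬ B.HasCentre (A.stalkSubring a)} ∩ (U : Set A.X)) ⊆ U) :
    ∃ (Y : ProjModel k K) (ψA : Y.Hom A) (ψB : Y.Hom B),
      (∀ y : Y.X, ψA.f y ∈ U → ModelCleanRegAt p g₀ Y y) ∧
      (∀ y : Y.X, ψB.f y ∈ UB → ModelCleanRegAt p g₀ Y y) := by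
  classical
  /- (1) a projective embedding `ιB : B ↪ ℙⁿ_k` and homogeneous coordinates `w` of `gen_B` -/
  obtain ⟨n, ιB, _, hιBw, w, hw, hgenB⟩ := B.exists_coords
  /- (2) the rational map `A ⋯→ B` -/
  let z : Fin (n + 1) → A.X.functionField := fun l => A.funFieldAlgEquiv.symm (w l)
  have hz : z ≠ 0 := ProjectiveSpace.algHom_comp_ne_zero A.funFieldAlgEquiv.symm.toAlgHom hw
  have hz' : ∃ i, z i ≠ 0 := by
    by_contra h
    push Not at h
    exact hz (funext h)
  have hInd : {a : A.X | ¬ IsDefinedAt z a} = {a : A.X | ¬ B.HasCentre (A.stalkSubring a)} := by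
    ext a
    simp only [Set.mem_setOf_eq, hasCentre_stalkSubring_iff_isDefinedAt A B ιB hιBw w hw hgenB a]
    rfl
  /- (3) the open subscheme `U` (integral) -/
  haveI : Nonempty (U : Scheme.{0}) := hUne.to_subtype
  haveI hintU : IsIntegral (U : Scheme.{0}) := isIntegral_of_isOpenImmersion U.ι
  /- (4) the base ideal on `U`; its principalization (Axiom 4 for `P_clean`), extended to `A`, keeping cleanness -/
  let J : (U : Scheme.{0}).IdealSheafData := (baseIdeal z).comap U.ι
  have hJ : J ≠ ⊥ := by
    intro hbot
    let y : (U : Scheme.{0}) := Classical.arbitrary _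
    have h1 : stalkIdeal J y = ⊥ := by rw [hbot, stalkIdeal_bot]
    rw [stalkIdeal_comap_of_isOpenImmersion] at h1
    obtain ⟨b, hb, hb0⟩ := (Submodule.ne_bot_iff _).mp (stalkIdeal_baseIdeal_ne_bot hz' (U.ι y))
    apply hb0
    have hb' : (U.ι.stalkMap y).hom b ∈
        (stalkIdeal (baseIdeal z) (U.ι y)).map (U.ι.stalkMap y).hom := Ideal.mem_map_of_mem _ hb
    rw [h1, Ideal.mem_bot] at hb'
    exact (asIso (U.ι.stalkMap y)).commRingCatIsoToRingEquiv.injective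
      (hb'.trans (map_zero _).symm)
  obtain ⟨S', X', σ, ρ, j', hintS', hint', hdomρ, hj', hσ, hprinc, hpb, hprop, hbir, hprojρ, hover, hisoP, hclean⟩ :=
    exists_cleanExtension hT4 hp htr g₀ A U hU hUne J hJ
  haveI := hj'
  haveI := hint'
  haveI := hprop
  haveI := hisoP
  haveI := hintS'
  haveI : IsLocallyNoetherian X' := LocallyOfFiniteType.isLocallyNoetherian ρ
  /- (5) the open `P = A ∖ closure (Ind ∩ U)` over which `ρ` is an isomorphism contains `A ∖ U`
    (no bad points) and the generic point -/
  let P : A.X.Opens := principalOpen U.ι J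
  have hFsub : closure (U.ι '' (nonPrincipalLocus J : Set U)) ⊆
      closure ({a : A.X | ¬ B.HasCentre (A.stalkSubring a)} ∩ (U : Set A.X)) := by
    refine closure_mono ?_
    rintro _ ⟨u, hu, rfl⟩
    refine ⟨?_, by rw [Scheme.Opens.ι_apply]; exact u.2⟩
    rw [← hInd]
    exact fun hdef => hu ((isLocallyPrincipalAt_baseIdeal hdef).comap U.ι)
  have hPsing : ∀ a : A.X, a ∉ (U : Set A.X) → a ∈ P := by
    intro a haU hamem
    exact haU (hnb (hFsub hamem))
  have hPne : (P : Set A.X).Nonempty := by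
    refine ⟨genericPoint A.X, fun hmem => ?_⟩
    let O : Set A.X := U.ι '' ((nonPrincipalLocus J : Set U)ᶜ)
    have hO : IsOpen O :=
      U.ι.isOpenEmbedding.isOpenMap _ (nonPrincipalLocus J).isClosed.isOpen_compl
    have hξO : genericPoint A.X ∈ O :=
      ⟨genericPoint U, genericPoint_not_mem_nonPrincipalLocus hJ,
        genericPoint_eq_of_isOpenImmersion U.ι⟩
    obtain ⟨_, ⟨u, hu, rfl⟩, ⟨u', hu', he⟩⟩ := mem_closure_iff.mp hmem O hO hξO
    exact hu (U.ι.isOpenEmbedding.injective he ▸ hu')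
  /- (6) `X'` as a projective model `A''` dominating `A`, clean-regular over `U` -/
  let A'' : ProjModel k K := ofModification A ρ P hPne hprojρ
  let ψρ : A''.Hom A := ofModificationHom A ρ P hPne hprojρ
  have hψρf : ψρ.f = ρ := rfl
  have hcleanX' : ∀ y : X', ρ y ∈ (U : Set A.X) → ModelCleanRegAt p g₀ A'' y := by
    intro y hy
    obtain ⟨s', rfl⟩ := hover y (by rwa [Scheme.Opens.range_ι])
    exact (modelCleanRegAt_ofModification_iff A ρ P hPne hprojρ (j' s')).mpr (hclean s')
  /- (7) the transported rational map on `X'`, defined over `j'(S')` -/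
  let z' : Fin (n + 1) → X'.functionField := fun l => RatFn.functionFieldMap ρ (z l)
  have hz'eq : z' = fun l => A''.funFieldAlgEquiv.symm (w l) :=
    funext fun l => functionFieldMap_funFieldIso_inv ψρ (w l)
  have hdef' : ∀ s' : S', IsDefinedAt z' (j' s') := by
    intro s'
    refine isDefinedAt_of_isLocallyPrincipalAt_comap ρ hz'
      (isLocallyPrincipalAt_of_comap_isOpenImmersion j' _ ?_)
    have h := hprinc s'
    have hJσ : J.comap σ = ((baseIdeal z).comap ρ).comap j' := by
      change ((baseIdeal z).comap U.ι).comap σ = _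
      rw [← Scheme.IdealSheafData.comap_comp, ← Scheme.IdealSheafData.comap_comp, hpb.w]
    rwa [hJσ] at h
  /- (8) the open `W` of definition; the join `Y = J(A'', B)` is `A''` over `W` -/
  have hz'' : ∃ i, z' i ≠ 0 := by
    obtain ⟨i, hi⟩ := hz'
    exact ⟨i, (map_ne_zero _).mpr hi⟩
  let W : X'.Opens := ⟨{y | IsDefinedAt z' y}, by
    have h := (isClosed_setOf_not_isDefinedAt hz'').isOpen_compl
    rwa [Set.compl_setOf, funext fun x => propext not_not] at h⟩
  have hWne : (W : Set X').Nonempty := ⟨j' (Classical.arbitrary S'), hdef' _⟩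
  have hWdef : ∀ y ∈ W, IsDefinedAt (fun l => A''.funFieldAlgEquiv.symm (w l)) y :=
    fun y hy => by rw [← hz'eq]; exact hy
  have hisoW : IsIso ((joinFst A'' B).f ∣_ W) :=
    isIso_joinFst_morphismRestrict_of_isDefinedAt A'' B ιB hιBw w hw hgenB W hWne hWdef
  /- (9) `Y` is `B` over `η⁻¹(P)` -/
  let VB : B.X.Opens := η.f ⁻¹ᵁ P
  have hηξ : η.f (genericPoint B.X) = genericPoint A.X := by
    rw [← B.genericPt_eq, ← Scheme.Hom.comp_apply, η.gen_f, A.genericPt_eq]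
  have hVBne : (VB : Set B.X).Nonempty :=
    ⟨genericPoint B.X, show η.f (genericPoint B.X) ∈ P from hηξ ▸ A.genericPoint_mem hPne⟩
  let f₁ : (VB : Scheme.{0}) ⟶ A''.X := (η.f ∣_ P) ≫ invOver A ρ P
  have hf₁ : f₁ ≫ A''.π = VB.ι ≫ B.π := by
    change ((η.f ∣_ P) ≫ invOver A ρ P) ≫ ρ ≫ A.π = VB.ι ≫ B.π
    rw [Category.assoc, invOver_ρ_assoc, ← Category.assoc, morphismRestrict_ι, Category.assoc,
      η.f_π]
  let sB : Spec (CommRingCat.of K) ⟶ VB := B.genLift hVBne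
  have h₂B : sB ≫ VB.ι = B.gen := B.genLift_ι hVBne
  have hsBP : sB ≫ (η.f ∣_ P) = A.genLift hPne := by
    rw [← cancel_mono P.ι, Category.assoc, morphismRestrict_ι, ← Category.assoc, h₂B, η.gen_f,
      genLift_ι]
  have h₁B : sB ≫ f₁ = A''.gen := by
    change sB ≫ (η.f ∣_ P) ≫ invOver A ρ P = A.genLift hPne ≫ invOver A ρ P
    rw [← Category.assoc, hsBP]
  have hisoB : IsIso ((joinSnd A'' B).f ∣_ VB) := isIso_joinSnd_morphismRestrict VB f₁ hf₁ sB h₂B h₁B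
  /- (10) conclusion -/
  have hcommf : (joinSnd A'' B).f ≫ η.f = (joinFst A'' B).f ≫ ρ := by
    have h := congrArg KModel.Hom.f (Hom.eq ((joinSnd A'' B).comp η) ((joinFst A'' B).comp ψρ))
    simpa only [Hom.comp_f, hψρf] using h
  have hcomm : ∀ y : (join A'' B).X,
      η.f ((joinSnd A'' B).f y) = ρ ((joinFst A'' B).f y) := fun y => by
    rw [← Scheme.Hom.comp_apply, hcommf, Scheme.Hom.comp_apply]
    rfl
  have hcleanW : ∀ y : (join A'' B).X, ρ ((joinFst A'' B).f y) ∈ (U : Set A.X) →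
      ModelCleanRegAt p g₀ (join A'' B) y := by
    intro y hyU
    have hyW : (joinFst A'' B).f y ∈ W := by
      obtain ⟨s', hs'⟩ := hover _ (by rwa [Scheme.Opens.range_ι])
      change IsDefinedAt z' ((joinFst A'' B).f y)
      rw [← hs']
      exact hdef' s'
    haveI := hisoW
    exact ModelCleanRegAt.of_isIso_morphismRestrict (joinFst A'' B) W y hyW (hcleanX' _ hyU)
  refine ⟨join A'' B, (joinFst A'' B).comp ψρ, joinSnd A'' B, fun y hy => ?_, fun y hy => ?_⟩
  · rw [Hom.comp_f, Scheme.Hom.comp_apply, hψρf] at hy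
    exact hcleanW y hy
  · by_cases haU : ρ ((joinFst A'' B).f y) ∈ (U : Set A.X)
    · exact hcleanW y haU
    · have haP : η.f ((joinSnd A'' B).f y) ∈ P := by
        rw [hcomm]; exact hPsing _ haU
      haveI := hisoB
      exact ModelCleanRegAt.of_isIso_morphismRestrict (joinSnd A'' B) VB y haP (hUB _ hy)

end Summit.ResolutionOfSingularities.ResolutionOfSingularities.Theorems.RadicialJung.CleanModels

end
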